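import Summits.RiemannHypothesis.RiemannHypothesis.Theorems.PfPersistencePerronFakeNodelessCriterion
import HarnessLib

/-!
# PF persistence — PERRON-FAKE (S6), part 4: the named hypothesis PROVED at small windows
# (every real table, every form-domain ground state, `0 < a ≤ 1/8`)

`pub-rhpf` cell, unit `pub-rhpf-prover-perron` (S6; CASE-DAG §6 row PERRON-FAKE).  **Mechanism /
rigidity campaign; no RH claims.**  RH-free, definition-free: Mathlib + proved tree files only.

Part 3 names the domination hypothesis `PerronSourceDominated a w` and proves it EQUIVALENT to nodal
count `0` of every real form-domain ground state (`perronSourceDominated_iff`).  This file proves the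
INTEGRATED form of the lobe-balance law decides the sign outright in the archimedean regime:

* `aeOneSigned_of_fold_le_of_polar_lt_arch` (PROVED): at a window with `2a < log 2` (no prime length
  enters) and **`2 cosh a < ρ(2a)`** (`ρ = weilArchDensity`; the archimedean attraction at the LARGEST
  separation two points of the window can have beats the LARGEST polar repulsion), every real `u` of
  the finite-energy class `coreAdm a` that folding does not lower (`Q^w_a(u) ≤ Q^w_a(|u|)`, any real
  table `w`) is a.e. one-signed.  Proof: by the lobe-balance law (part 1) `∫ u⁻ S^w_u ≤ 0`; against
  `u⁻` the atomic part of the source vanishes (`log n = 0` on the index), the polar part is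
  `≤ 2cosh(a)·(∫u⁺)·u⁻`, and the archimedean part integrates to `≥ ρ(2a)·(∫u⁺)(∫u⁻)` (Tonelli on
  `u⁻(x)u⁺(x ± t)`, `∫_{t>0}(u⁺(x+t) + u⁺(x−t)) dt = ∫u⁺`, and `ρ(t) ≥ ρ(2a)` wherever the integrand
  lives); hence `(ρ(2a) − 2cosh a)(∫u⁺)(∫u⁻) ≤ 0`, so `u⁺ = 0` a.e. or `u⁻ = 0` a.e.
* `two_mul_cosh_lt_weilArchDensity_of_le` (PROVED numerics, fourth-order Taylor bounds for `e^{±1/8}`,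
  `e^{-3/8}`): `0 < a ≤ 1/8 ⇒ 2cosh a < ρ(2a)` (`2cosh(1/8) ≤ 2.016 < 2.23 ≤ ρ(1/4)`; the true
  threshold of the inequality is `a ≈ 0.139`).
* `aeOneSigned_of_fold_le_smallWindow`, `aeOneSigned_of_minimal_smallWindow`,
  `aeOneSigned_of_evenMinimal_smallWindow` (PROVED): for `0 < a ≤ 1/8`, every real member of the class
  not lowered by folding — in particular every real form-domain ground state of the FULL closed form
  `tableClosedForm a w` of ANY real table, and every real even-sector ground state — is a.e.
  one-signed.  Part 3 restates these as `AllGroundStatesOneSigned a w` / `PerronSourceDominated a w`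
  for `0 < a ≤ 1/8`.

Scope (honest): below `log 2 / 2` no table acts (the window sees no prime length), so this is a
theorem about the archimedean + polar form shared by every table — the regime is far below the
cell's served windows; it shows the typed input of part 3 is PROVED, not merely typed, on `(0, 1/8]`,
and that the lobe-balance mechanism decides signs by itself where the kernel inequality holds.
-/

set_option linter.dupNamespace false

noncomputable section

open MeasureTheory Set Filter Complex
open scoped Real Topology

namespace Summit.RiemannHypothesis.RiemannHypothesis.Theorems.PfPersistence

open Literature.NumberTheory.LFunctions
open Summit.RiemannHypothesis.RiemannHypothesis.Theorems.WeilGroundStateMarkovPart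
open Summit.RiemannHypothesis.RiemannHypothesis.Theorems.PolarPerronFrobenius

section SmallWindow

variable {a : ℝ} {u : ℝ → ℝ}

/-- `∫_{t>0} (v(x+t) + v(x−t)) dt = ∫ v` for an integrable `v`. [folklore] -/
theorem integral_Ioi_add_sub_eq {v : ℝ → ℝ} (hv : Integrable v) (x : ℝ) :
    ∫ t in Ioi (0 : ℝ), (v (x + t) + v (x - t)) = ∫ s, v s := by
  have h1 : ∫ t in Ioi (0 : ℝ), v (x + t) = ∫ s in Ioi x, v s := by
    have hmp : MeasurePreserving (fun t : ℝ ↦ x + t) volume volume :=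
      measurePreserving_add_left volume x
    have hme : MeasurableEmbedding (fun t : ℝ ↦ x + t) := measurableEmbedding_addLeft x
    have h := hmp.setIntegral_preimage_emb hme v (Ioi x)
    simpa [Set.preimage_const_add_Ioi] using h
  have h2 : ∫ t in Ioi (0 : ℝ), v (x - t) = ∫ s in Iio x, v s := by
    have hmp : MeasurePreserving (fun t : ℝ ↦ x - t) volume volume :=
      Measure.measurePreserving_sub_left volume x
    have hme : MeasurableEmbedding (fun t : ℝ ↦ x - t) := measurableEmbedding_subLeft x
    have h := hmp.setIntegral_preimage_emb hme v (Iio x)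
    simpa [Set.preimage_const_sub_Iio] using h
  have hi1 : IntegrableOn (fun t ↦ v (x + t)) (Ioi 0) := (hv.comp_add_left x).integrableOn
  have hi2 : IntegrableOn (fun t ↦ v (x - t)) (Ioi 0) := (hv.comp_sub_left x).integrableOn
  rw [integral_add hi1 hi2, h1, h2, add_comm, ← integral_Iic_eq_integral_Iio,
    intervalIntegral.integral_Iic_add_Ioi hv.integrableOn hv.integrableOn]

/-- **Small-window sign theorem (PROVED).**  At a window with `2a < log 2` and `2cosh a < ρ(2a)`, a
real member of the finite-energy class that folding does not lower is a.e. one-signed — for every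
real table `w`. [folklore] -/
theorem aeOneSigned_of_fold_le_of_polar_lt_arch (w : ℕ → ℝ) (hum : Measurable u)
    (hU : coreAdm a (fun x ↦ ((u x : ℝ) : ℂ))) (h2a : 2 * a < Real.log 2)
    (hker : 2 * Real.cosh a < weilArchDensity (2 * a))
    (hfold : tableClosedForm a w (fun x ↦ ((u x : ℝ) : ℂ)) ≤
      tableClosedForm a w (fun x ↦ ((|u x| : ℝ) : ℂ))) :
    (∀ᵐ y : ℝ, 0 ≤ u y) ∨ (∀ᵐ y : ℝ, u y ≤ 0) := by
  set U : ℝ → ℂ := fun x ↦ ((u x : ℝ) : ℂ) with hUdef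
  set A : ℝ → ℂ := fun x ↦ ((|u x| : ℝ) : ℂ) with hAdef
  have hU2 : MemLp U 2 volume := hU.1
  have hu2 : MemLp u 2 volume :=
    MemLp.of_le hU2 hum.aestronglyMeasurable (Eventually.of_forall fun x ↦ by simp [hUdef])
  have hus' : ∀ x : ℝ, x ∉ Icc (-a) a → u x = 0 := fun x hx ↦ by
    have h := hU.2.1 x hx
    simpa [hUdef] using h
  have hus : ∀ᵐ x : ℝ, x ∉ Icc (-a) a → u x = 0 := Eventually.of_forall hus'
  have hp2 := swg_memLp_posPart hu2
  have hn2 := swg_memLp_negPart hu2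
  have hp1 : Integrable fun x ↦ max (u x) 0 := swg_integrable_of_memLp hp2 (swg_posPart_ae_zero hus)
  have hn1 : Integrable fun x ↦ max (-u x) 0 := swg_integrable_of_memLp hn2 (swg_negPart_ae_zero hus)
  have hE : IntegrableOn (fun t ↦ weilArchDensity t * weilIncrement U t) (Ioi 0) := hU.2.2
  have hAeq : (fun x ↦ ((‖U x‖ : ℝ) : ℂ)) = A := by
    funext x; simp [hUdef, hAdef]
  have hEA : IntegrableOn (fun t ↦ weilArchDensity t * weilIncrement A t) (Ioi 0) := by
    have h := finiteEnergy_norm hU2 hE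
    rwa [hAeq] at h
  obtain ⟨harch, hIJ⟩ := swg_archGain_eq hum hu2 hE hEA
  -- the two masses
  have hmp0 : 0 ≤ ∫ x, max (u x) 0 := integral_nonneg fun x ↦ le_max_right _ _
  have hmn0 : 0 ≤ ∫ x, max (-u x) 0 := integral_nonneg fun x ↦ le_max_right _ _
  -- (1) lobe balance: `∫ u⁻ S ≤ 0`
  obtain ⟨hid, hIS⟩ := tableClosedForm_abs_sub_eq_source w hum hU
    (fun y ↦ (∫ t in Ioi (0 : ℝ), weilArchDensity t * (max (u (y + t)) 0 + max (u (y - t)) 0)) +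
      (∑ n ∈ weilPrimeIndex a, w n * (max (u (y + Real.log n)) 0 + max (u (y - Real.log n)) 0)) -
      2 * ∫ x, max (u x) 0 * Real.cosh ((x - y) / 2)) (fun y ↦ rfl)
  have hS0 : ∫ y, max (-u y) 0 *
      ((∫ t in Ioi (0 : ℝ), weilArchDensity t * (max (u (y + t)) 0 + max (u (y - t)) 0)) +
        (∑ n ∈ weilPrimeIndex a, w n * (max (u (y + Real.log n)) 0 + max (u (y - Real.log n)) 0)) -
        2 * ∫ x, max (u x) 0 * Real.cosh ((x - y) / 2)) ≤ 0 := by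
    have h0 : 0 ≤ tableClosedForm a w A - tableClosedForm a w U := sub_nonneg.2 hfold
    rw [hid] at h0
    linarith
  -- (2) the atomic part vanishes against `u⁻` (no prime length enters the window)
  have hlog0 : ∀ n ∈ weilPrimeIndex a, Real.log (n : ℝ) = 0 := by
    intro n hn
    have hlt : Real.log (n : ℝ) < Real.log 2 := (mem_weilPrimeIndex.1 hn).trans h2a
    have hn2 : n < 2 := by
      by_contra h
      push Not at h
      have h' : (2 : ℝ) ≤ n := by exact_mod_cast h
      have : Real.log 2 ≤ Real.log (n : ℝ) := Real.log_le_log (by norm_num) h'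
      linarith
    interval_cases n <;> simp
  have hP0 : ∀ y, max (-u y) 0 *
      (∑ n ∈ weilPrimeIndex a, w n * (max (u (y + Real.log n)) 0 + max (u (y - Real.log n)) 0)) =
        0 := by
    intro y
    have hpm : max (-u y) 0 * max (u y) 0 = 0 := by
      rcases le_total 0 (u y) with h | h
      · rw [max_eq_right (by linarith : -u y ≤ 0), zero_mul]
      · rw [max_eq_right h, mul_zero]
    rw [Finset.mul_sum]
    refine Finset.sum_eq_zero fun n hn ↦ ?_
    rw [hlog0 n hn, add_zero, sub_zero]
    calc max (-u y) 0 * (w n * (max (u y) 0 + max (u y) 0))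
        = 2 * w n * (max (-u y) 0 * max (u y) 0) := by ring
      _ = 0 := by rw [hpm, mul_zero]
  -- (3) the polar part against `u⁻` is at most `2cosh(a)·m₊·u⁻`
  have hcont : ∀ y, Continuous fun x : ℝ ↦ Real.cosh ((x - y) / 2) := fun y ↦
    Real.continuous_cosh.comp ((continuous_id.sub continuous_const).div_const 2)
  have hRle : ∀ y, max (-u y) 0 * (2 * ∫ x, max (u x) 0 * Real.cosh ((x - y) / 2)) ≤
      max (-u y) 0 * (2 * Real.cosh a * ∫ x, max (u x) 0) := by
    intro y
    by_cases hy : y ∈ Icc (-a) a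
    · refine mul_le_mul_of_nonneg_left ?_ (le_max_right _ _)
      have ha0 : 0 ≤ a := by
        have := hy.1.trans hy.2
        linarith
      rw [show 2 * Real.cosh a * ∫ x, max (u x) 0 = 2 * ∫ x, max (u x) 0 * Real.cosh a by
        rw [integral_mul_const]; ring]
      refine mul_le_mul_of_nonneg_left (integral_mono
        (swg_integrable_mul_continuous hp1 (swg_posPart_ae_zero hus) (hcont y)) (hp1.mul_const _)
        fun x ↦ ?_) two_pos.le
      by_cases hx : x ∈ Icc (-a) a
      · refine mul_le_mul_of_nonneg_left ?_ (le_max_right _ _)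
        rw [Real.cosh_le_cosh, abs_of_nonneg ha0, abs_le]
        constructor
        · linarith [hx.1, hy.2]
        · linarith [hx.2, hy.1]
      · simp only [hus' x hx, max_self, zero_mul, le_refl]
    · simp only [hus' y hy, neg_zero, max_self, zero_mul, le_refl]
  -- (4) the archimedean part against `u⁻` is at least `ρ(2a)·m₊·m₋`
  -- the integrand on `(t, x)`
  set F : ℝ × ℝ → ℝ := fun q ↦ max (-u q.2) 0 * (max (u (q.2 + q.1)) 0 + max (u (q.2 - q.1)) 0)
    with hF
  have hpm : Measurable fun x ↦ max (u x) 0 := hum.max measurable_const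
  have hnm : Measurable fun x ↦ max (-u x) 0 := hum.neg.max measurable_const
  have hFm : Measurable F :=
    (hnm.comp measurable_snd).mul
      ((hpm.comp (measurable_snd.add measurable_fst)).add (hpm.comp (measurable_snd.sub measurable_fst)))
  have hF0 : ∀ q, 0 ≤ F q := fun q ↦
    mul_nonneg (le_max_right _ _) (add_nonneg (le_max_right _ _) (le_max_right _ _))
  have hfib : ∀ x, Integrable (fun t ↦ F (t, x)) (volume.restrict (Ioi 0)) := fun x ↦
    (((hp1.comp_add_left x).add (hp1.comp_sub_left x)).const_mul (max (-u x) 0)).restrict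
  have hfibint : ∀ x, ∫ t in Ioi (0 : ℝ), F (t, x) = max (-u x) 0 * ∫ s, max (u s) 0 := by
    intro x
    simp only [hF]
    rw [integral_const_mul, integral_Ioi_add_sub_eq hp1 x]
  have hFint : Integrable F ((volume.restrict (Ioi (0 : ℝ))).prod volume) := by
    refine (integrable_prod_iff' hFm.aestronglyMeasurable).2 ⟨Eventually.of_forall hfib, ?_⟩
    have e : (fun x ↦ ∫ t in Ioi (0 : ℝ), ‖F (t, x)‖) = fun x ↦ max (-u x) 0 * ∫ s, max (u s) 0 := by
      funext x
      rw [← hfibint x]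
      exact integral_congr_ae (Eventually.of_forall fun t ↦ Real.norm_of_nonneg (hF0 _))
    rw [e]
    exact hn1.mul_const _
  have hGint : Integrable (fun t ↦ ∫ x, F (t, x)) (volume.restrict (Ioi 0)) :=
    hFint.integral_prod_left
  have hGval : ∫ t in Ioi (0 : ℝ), ∫ x, F (t, x) = (∫ x, max (u x) 0) * ∫ x, max (-u x) 0 := by
    have hsw := integral_integral_swap (μ := volume.restrict (Ioi (0 : ℝ))) (ν := volume)
      (f := fun t x ↦ F (t, x)) hFint
    rw [hsw]
    have e : (fun x ↦ ∫ t in Ioi (0 : ℝ), F (t, x)) = fun x ↦ max (-u x) 0 * ∫ s, max (u s) 0 :=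
      funext hfibint
    rw [e, integral_mul_const, mul_comm]
  -- pointwise comparison of the archimedean integrands on `(0, ∞)`
  have hG : ∀ t, weilIncrement U t - weilIncrement A t = 4 * ∫ x, F (t, x) := by
    intro t
    rw [swg_weilIncrement_sub_abs hu2 t]
  have hlow : ∫ t in Ioi (0 : ℝ), weilArchDensity (2 * a) * (4 * ∫ x, F (t, x)) ≤
      ∫ t in Ioi (0 : ℝ), weilArchDensity t * (weilIncrement U t - weilIncrement A t) := by
    refine setIntegral_mono_on ((hGint.const_mul 4).const_mul _)
      ((hE.sub hEA).congr (Eventually.of_forall fun t ↦ (mul_sub _ _ _).symm)) measurableSet_Ioi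
      fun t ht ↦ ?_
    have ht0 : 0 < t := ht
    rw [hG t]
    by_cases ht2 : t ≤ 2 * a
    · exact mul_le_mul_of_nonneg_right
        (weilArchDensity_antitoneOn (mem_Ioi.2 ht0) (mem_Ioi.2 (ht0.trans_le ht2)) ht2)
        (mul_nonneg (by norm_num) (integral_nonneg fun x ↦ hF0 _))
    · have hzero : ∫ x, F (t, x) = 0 := by
        refine integral_eq_zero_of_ae (Eventually.of_forall fun x ↦ ?_)
        simp only [hF, Pi.zero_apply]
        by_cases hx : x ∈ Icc (-a) a
        · push Not at ht2
          have h1 : x + t ∉ Icc (-a) a := fun h ↦ by linarith [h.2, hx.1]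
          have h2 : x - t ∉ Icc (-a) a := fun h ↦ by linarith [h.1, hx.2]
          rw [hus' _ h1, hus' _ h2, max_self, add_zero, mul_zero]
        · rw [hus' x hx, neg_zero, max_self, zero_mul]
      rw [hzero, mul_zero, mul_zero, mul_zero]
  have hAge : weilArchDensity (2 * a) * ((∫ x, max (u x) 0) * ∫ x, max (-u x) 0) ≤
      ∫ y, max (-u y) 0 *
        ∫ t in Ioi (0 : ℝ), weilArchDensity t * (max (u (y + t)) 0 + max (u (y - t)) 0) := by
    have h := hlow
    rw [harch, integral_const_mul, integral_const_mul, hGval] at h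
    linarith
  -- (5) assemble: `(ρ(2a) − 2cosh a)·m₊·m₋ ≤ 0`
  have hcomb : ∫ y, (max (-u y) 0 *
      (∫ t in Ioi (0 : ℝ), weilArchDensity t * (max (u (y + t)) 0 + max (u (y - t)) 0)) -
        max (-u y) 0 * (2 * Real.cosh a * ∫ x, max (u x) 0)) ≤
      ∫ y, max (-u y) 0 *
        ((∫ t in Ioi (0 : ℝ), weilArchDensity t * (max (u (y + t)) 0 + max (u (y - t)) 0)) +
          (∑ n ∈ weilPrimeIndex a, w n * (max (u (y + Real.log n)) 0 + max (u (y - Real.log n)) 0)) -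
          2 * ∫ x, max (u x) 0 * Real.cosh ((x - y) / 2)) := by
    refine integral_mono (hIJ.sub (hn1.mul_const _)) hIS fun y ↦ ?_
    have h1 := hP0 y
    have h2 := hRle y
    simp only
    rw [mul_sub, mul_add, h1, add_zero]
    linarith
  rw [integral_sub hIJ (hn1.mul_const _), integral_mul_const] at hcomb
  have hprod : (weilArchDensity (2 * a) - 2 * Real.cosh a) *
      ((∫ x, max (u x) 0) * ∫ x, max (-u x) 0) ≤ 0 := by
    nlinarith [hAge, hcomb, hS0]
  have hgap : 0 < weilArchDensity (2 * a) - 2 * Real.cosh a := sub_pos.2 hker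
  have hmm : (∫ x, max (u x) 0) * ∫ x, max (-u x) 0 ≤ 0 := by
    by_contra h
    push Not at h
    nlinarith
  have hz : (∫ x, max (u x) 0) = 0 ∨ (∫ x, max (-u x) 0) = 0 := by
    by_contra h
    push Not at h
    have h1 : 0 < ∫ x, max (u x) 0 := lt_of_le_of_ne hmp0 (Ne.symm h.1)
    have h2 : 0 < ∫ x, max (-u x) 0 := lt_of_le_of_ne hmn0 (Ne.symm h.2)
    nlinarith [mul_pos h1 h2]
  rcases hz with h | h
  · right
    have h' := (integral_eq_zero_iff_of_nonneg (fun x ↦ le_max_right _ _) hp1).1 h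
    filter_upwards [h'] with x hx
    have hx' : max (u x) 0 = 0 := hx
    exact max_eq_right_iff.1 hx'
  · left
    have h' := (integral_eq_zero_iff_of_nonneg (fun x ↦ le_max_right _ _) hn1).1 h
    filter_upwards [h'] with x hx
    have hx' : max (-u x) 0 = 0 := hx
    have := max_eq_right_iff.1 hx'
    linarith

/-! ### Numerics: `0 < a ≤ 1/8 ⇒ 2a < log 2` and `2cosh a < ρ(2a)` -/

/-- `e^{1/8} ≤ 1.1332` (fourth-order Taylor bound). [folklore] -/
theorem exp_one_eighth_le : Real.exp (1 / 8) ≤ 11332 / 10000 := by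
  have h := Real.exp_bound' (show (0 : ℝ) ≤ 1 / 8 by norm_num) (show (1 / 8 : ℝ) ≤ 1 by norm_num)
    (show 0 < 4 by norm_num)
  norm_num [Finset.sum_range_succ, Nat.factorial] at h
  linarith

/-- `e^{-1/8} ≤ 0.8826` (fourth-order Taylor bound). [folklore] -/
theorem exp_neg_one_eighth_le : Real.exp (-(1 / 8)) ≤ 8826 / 10000 := by
  have h := Real.exp_bound (x := -(1 / 8 : ℝ)) (by norm_num [abs_le]) (n := 4) (by norm_num)
  have h' := abs_le.1 h
  norm_num [Finset.sum_range_succ, Nat.factorial] at h'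
  linarith [h'.1, h'.2]

/-- `0.6854 ≤ e^{-3/8}` (fourth-order Taylor bound). [folklore] -/
theorem le_exp_neg_three_eighths : (6854 / 10000 : ℝ) ≤ Real.exp (-(3 / 8)) := by
  have h := Real.exp_bound (x := -(3 / 8 : ℝ)) (by norm_num [abs_le]) (n := 4) (by norm_num)
  have h' := abs_le.1 h
  norm_num [Finset.sum_range_succ, Nat.factorial] at h'
  linarith [h'.1, h'.2]

/-- `2cosh(1/8) ≤ 2.0158`. [folklore] -/
theorem two_mul_cosh_one_eighth_le : 2 * Real.cosh (1 / 8) ≤ 20158 / 10000 := by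
  rw [Real.cosh_eq]
  have h1 := exp_one_eighth_le
  have h2 := exp_neg_one_eighth_le
  linarith

/-- `2.23 ≤ ρ(1/4)`. [folklore] -/
theorem le_weilArchDensity_quarter : (223 / 100 : ℝ) ≤ weilArchDensity (1 / 4) := by
  rw [weilArchDensity_eq_inv (by norm_num : (0 : ℝ) < 1 / 4)]
  have e1 : Real.exp ((1 / 4 : ℝ) / 2) = Real.exp (1 / 8) := by norm_num
  have e2 : Real.exp (-(3 * (1 / 4 : ℝ) / 2)) = Real.exp (-(3 / 8)) := by norm_num
  rw [e1, e2]
  have h1 := exp_one_eighth_le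
  have h2 := le_exp_neg_three_eighths
  have hpos : 0 < Real.exp (1 / 8) - Real.exp (-(3 / 8)) :=
    sub_pos.2 (Real.exp_lt_exp.2 (by norm_num))
  rw [le_inv_comm₀ (by norm_num) hpos]
  have : Real.exp (1 / 8) - Real.exp (-(3 / 8)) ≤ 4478 / 10000 := by linarith
  exact this.trans (by norm_num)

/-- `0 < a ≤ 1/8 ⇒ 2a < log 2`. [folklore] -/
theorem two_mul_lt_log_two_of_le (ha : a ≤ 1 / 8) : 2 * a < Real.log 2 := by
  have h := Real.log_two_gt_d9
  linarith

/-- **The kernel inequality at small windows (PROVED)**: `0 < a ≤ 1/8 ⇒ 2cosh a < ρ(2a)`. [folklore] -/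
theorem two_mul_cosh_lt_weilArchDensity_of_le (ha0 : 0 < a) (ha : a ≤ 1 / 8) :
    2 * Real.cosh a < weilArchDensity (2 * a) := by
  have hcosh : Real.cosh a ≤ Real.cosh (1 / 8) := by
    rw [Real.cosh_le_cosh, abs_of_pos ha0, abs_of_pos (by norm_num : (0 : ℝ) < 1 / 8)]
    exact ha
  have hρ : weilArchDensity (1 / 4) ≤ weilArchDensity (2 * a) :=
    weilArchDensity_antitoneOn (mem_Ioi.2 (by linarith : (0 : ℝ) < 2 * a))
      (mem_Ioi.2 (by norm_num : (0 : ℝ) < 1 / 4)) (by linarith)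
  have h1 := two_mul_cosh_one_eighth_le
  have h2 := le_weilArchDensity_quarter
  linarith

/-! ### Corollaries at `0 < a ≤ 1/8` -/

/-- **Small windows (PROVED)**: for `0 < a ≤ 1/8` and every real table, a real member of the
finite-energy class that folding does not lower is a.e. one-signed. [folklore] -/
theorem aeOneSigned_of_fold_le_smallWindow (w : ℕ → ℝ) (hum : Measurable u)
    (hU : coreAdm a (fun x ↦ ((u x : ℝ) : ℂ))) (ha0 : 0 < a) (ha : a ≤ 1 / 8)
    (hfold : tableClosedForm a w (fun x ↦ ((u x : ℝ) : ℂ)) ≤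
      tableClosedForm a w (fun x ↦ ((|u x| : ℝ) : ℂ))) :
    (∀ᵐ y : ℝ, 0 ≤ u y) ∨ (∀ᵐ y : ℝ, u y ≤ 0) :=
  aeOneSigned_of_fold_le_of_polar_lt_arch w hum hU (two_mul_lt_log_two_of_le ha)
    (two_mul_cosh_lt_weilArchDensity_of_le ha0 ha) hfold

/-- Rewriting `‖·‖` of a real-valued function as `|·|` inside the fold inequality. [folklore] -/
private theorem fold_real_sw {w : ℕ → ℝ} {U : ℝ → ℝ}
    (h : tableClosedForm a w (fun x ↦ ((U x : ℝ) : ℂ)) ≤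
      tableClosedForm a w (fun x ↦ ((‖((U x : ℝ) : ℂ)‖ : ℝ) : ℂ))) :
    tableClosedForm a w (fun x ↦ ((U x : ℝ) : ℂ)) ≤ tableClosedForm a w (fun x ↦ ((|U x| : ℝ) : ℂ)) := by
  have e : (fun x ↦ ((‖((U x : ℝ) : ℂ)‖ : ℝ) : ℂ)) = fun x ↦ ((|U x| : ℝ) : ℂ) := by funext x; simp
  rwa [e] at h

/-- **Every real form-domain ground state of the full closed form of ANY real table at a window
`0 < a ≤ 1/8` is a.e. one-signed (PROVED).** [folklore] -/
theorem aeOneSigned_of_minimal_smallWindow (w : ℕ → ℝ) (hum : Measurable u)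
    (hU : coreAdm a (fun x ↦ ((u x : ℝ) : ℂ))) (ha0 : 0 < a) (ha : a ≤ 1 / 8)
    (hN : ∫ x, ‖((u x : ℝ) : ℂ)‖ ^ 2 = (1 : ℝ))
    (hmin : ∀ v : ℝ → ℂ, coreAdm a v →
      tableClosedForm a w (fun x ↦ ((u x : ℝ) : ℂ)) * (∫ x, ‖v x‖ ^ 2) ≤ tableClosedForm a w v) :
    (∀ᵐ y : ℝ, 0 ≤ u y) ∨ (∀ᵐ y : ℝ, u y ≤ 0) :=
  aeOneSigned_of_fold_le_smallWindow w hum hU ha0 ha (fold_real_sw (fold_le_of_minimal hU hN hmin))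

/-- **Every real even-sector ground state at a window `0 < a ≤ 1/8` is a.e. one-signed (PROVED).**
[folklore] -/
theorem aeOneSigned_of_evenMinimal_smallWindow (w : ℕ → ℝ) (hum : Measurable u)
    (hU : coreAdm a (fun x ↦ ((u x : ℝ) : ℂ))) (ha0 : 0 < a) (ha : a ≤ 1 / 8)
    (he : ∀ x, u (-x) = u x) (hN : ∫ x, ‖((u x : ℝ) : ℂ)‖ ^ 2 = (1 : ℝ))
    (hmin : ∀ v : ℝ → ℂ, coreAdm a v → (∀ x, v (-x) = v x) →
      tableClosedForm a w (fun x ↦ ((u x : ℝ) : ℂ)) * (∫ x, ‖v x‖ ^ 2) ≤ tableClosedForm a w v) :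
    (∀ᵐ y : ℝ, 0 ≤ u y) ∨ (∀ᵐ y : ℝ, u y ≤ 0) :=
  aeOneSigned_of_fold_le_smallWindow w hum hU ha0 ha
    (fold_real_sw (fold_le_of_evenMinimal hU (fun x ↦ by simp [he x]) hN hmin))

end SmallWindow

end Summit.RiemannHypothesis.RiemannHypothesis.Theorems.PfPersistence

end
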